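import Literature.NumberTheory.Irrationality.LaiYu2020.ArithmeticLemmaProofs
import Literature.NumberTheory.Irrationality.LaiYu2020.LinearFormsProofs
import Literature.NumberTheory.Irrationality.FischlerSprangZudilin2019.LinearForms
import HarnessLib

/-!
# Lai–Yu 2020, Lemma 3.3 (arithmetic lemma), second half: `d_{n+1}^{s+1} ρ_{0,θ} ∈ ℤ` — proofs

Topic `Literature/NumberTheory/Irrationality/LaiYu2020`. Companion ("Proofs") file for
L. Lai, P. Yu, *A note on the number of irrational odd zeta values*, Compositio Math. **156** (2020)
1699–1717 = arXiv:1911.08458 [LaiYu2020], §3 Lemma 3.3 (arXiv text p. 7):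

> «… and we have `d_{n+1}^{s+1} ρ_{0,θ} ∈ ℤ` for all `θ ∈ 𝓕_B`. … Once `d_n^{s+1−i} a_{i,k} ∈ ℤ` is
> established, the rest of the proof is the same as [FSZ2019]. We only mention that the most remarkable
> part is `d_{n+1}^{s+1} ρ_{0,θ} ∈ ℤ`, which is proved by showing `∑_{i=1}^{s} d_{n+1}^{s+1} a_{i,k}/(ℓ+θ)^i`
> is an integer for any `0 ≤ ℓ ≤ k ≤ n` and `θ ∈ 𝓕_B`. It uses the fact that `R_n(t)` has zeros
> `−n+θ, −n+1+θ, −n+2+θ, ⋯, θ` for `θ ∈ 𝓕_B ∖ {1}`, this observation origins from Sprang [Sp18].»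

PROVED here (theorems only, no named facts; sorry-free) by transplanting the tree's proof of
[FSZ2019, Lemma 2 (3.2)] (`FischlerSprangZudilin2019.lemma2_rhoZero`; its `p`-adic window lemma
`not_two_bad` is used as is, with `D ↦ b = den θ`, `j ↦ a = num θ`):

* `R_shift_eq_zero` — the zeros `ℓ − k + θ` (`0 ≤ ℓ ≤ k ≤ n`, `θ ∈ 𝓕_B ∖ {1}`, `rn ≥ 1`) of `R_n`;
* `sum_innerSum_window_eq_zero` — (3.5): `∑_{k'} E_{k'}(ℓ − k + k') = 0` with
  `E_{k'}(m) = ∑_i d^{s+1} a_{i,k'}/(m+θ)^i`;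
* `exists_int_innerSum` — `E_k(ℓ) ∈ ℤ` (`p`-integral for every `p`: good points directly from
  `d^{s+1−i} a_{i,k} ∈ ℤ` (`ArithmeticLemmaProofs.lemma33_coeff_isInt`) and `d b/(bm+a)`; a bad point is
  minus the sum of the good points of its window, at most one bad point per window; `θ = 1` directly);
* `lemma33_rhoZero_isInt` — **`d^{s+1} ρ_{0,θ} ∈ ℤ`** for every common multiple `d` of `1, …, n+1`
  (`ρ_{0,θ}` exactly as in `LinearFormsProofs.lemma25`).

## References

* [LaiYu2020] L. Lai, P. Yu, Compositio Math. 156 (2020) 1699–1717, §3 Lemma 3.3 (second assertion).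
* [FischlerSprangZudilin2019] §3 Lemma 2, eq. (3.2)–(3.5) (tree: `FischlerSprangZudilin2019.lemma2_rhoZero`).
-/

noncomputable section

open Finset Polynomial

namespace Literature.NumberTheory.Irrationality.LaiYu2020

open Literature.NumberTheory.Transcendental.BallRivoal (pfEval)
open Literature.NumberTheory.Irrationality.FischlerSprangZudilin2019 (not_two_bad)

/-! ### `p`-integral rationals (bookkeeping, as in the tree's FSZ file) -/

/-! `x ∈ ℚ` is `p`-integral iff `p` does not divide the (reduced) denominator of `x`; we write the
condition `¬ p ∣ x.den` out (no definition; the tree's FSZ file uses a private def `PIntegral`). -/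

namespace PIntegral

variable {p : ℕ}

/-- Integers are `p`-integral. [folklore] -/
private theorem intCast (hp : p.Prime) (z : ℤ) : ¬ p ∣ ((z : ℚ)).den := by
  rw [Rat.den_intCast]
  exact hp.not_dvd_one

/-- Closure under addition. [folklore] -/
private theorem add (hp : p.Prime) {x y : ℚ} (hx : ¬ p ∣ x.den) (hy : ¬ p ∣ y.den) :
    ¬ p ∣ (x + y).den := by
  intro h
  rcases (Nat.Prime.dvd_mul hp).1 (h.trans (Rat.add_den_dvd x y)) with h1 | h1
  · exact hx h1
  · exact hy h1

/-- Closure under multiplication. [folklore] -/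
private theorem mul (hp : p.Prime) {x y : ℚ} (hx : ¬ p ∣ x.den) (hy : ¬ p ∣ y.den) :
    ¬ p ∣ (x * y).den := by
  intro h
  rcases (Nat.Prime.dvd_mul hp).1 (h.trans (Rat.mul_den_dvd x y)) with h1 | h1
  · exact hx h1
  · exact hy h1

/-- Closure under negation. [folklore] -/
private theorem neg {x : ℚ} (hx : ¬ p ∣ x.den) : ¬ p ∣ (-x).den := by
  rw [Rat.neg_den]; exact hx

/-- Closure under powers. [folklore] -/
private theorem pow (hp : p.Prime) {x : ℚ} (hx : ¬ p ∣ x.den) (k : ℕ) : ¬ p ∣ (x ^ k).den := by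
  induction k with
  | zero => rw [pow_zero]; exact_mod_cast intCast hp 1
  | succ k ih => rw [pow_succ]; exact mul hp ih hx

/-- Closure under finite sums. [folklore] -/
private theorem sum (hp : p.Prime) {ι : Type*} (S : Finset ι) {f : ι → ℚ} (hf : ∀ i ∈ S, ¬ p ∣ (f i).den) :
    ¬ p ∣ (∑ i ∈ S, f i).den := by
  classical
  induction S using Finset.induction_on with
  | empty => rw [sum_empty]; exact_mod_cast intCast hp 0
  | insert a S ha ih =>
    rw [sum_insert ha]
    exact add hp (hf a (mem_insert_self a S)) (ih fun i hi => hf i (mem_insert_of_mem hi))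

/-- A rational that is `p`-integral for every prime `p` is an integer. [folklore] -/
private theorem exists_int_of_forall {x : ℚ} (h : ∀ p : ℕ, p.Prime → ¬ p ∣ x.den) : ∃ z : ℤ, x = z := by
  by_cases hd : x.den = 1
  · exact ⟨x.num, (Rat.coe_int_num_of_den_eq_one hd).symm⟩
  · obtain ⟨p, hp, hpd⟩ := Nat.exists_prime_and_dvd hd
    exact absurd hpd (h p hp)

/-- **The valuation criterion**: `a/b` (`a ∈ ℕ`, `b ∈ ℤ ∖ {0}`) is `p`-integral as soon as `p^{w+1} ∤ b`,
where `w = v_p(a)` (i.e. `v_p(b) ≤ v_p(a)`; for `a = 0` the hypothesis reads `p ∤ b`). [folklore] -/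
private theorem div_of_not_pow_dvd (hp : p.Prime) (a : ℕ) (b : ℤ) (hb : b ≠ 0)
    (h : ¬ (p : ℤ) ^ (a.factorization p + 1) ∣ b) : ¬ p ∣ (((a : ℚ) / b)).den := by
  -- reduce to `b > 0`
  wlog hbpos : 0 < b generalizing b
  · have hb' : 0 < -b := by omega
    have h' : ¬ (p : ℤ) ^ (a.factorization p + 1) ∣ -b := fun hd => h (dvd_neg.1 hd)
    have := this (-b) (by omega) h' hb'
    rw [Int.cast_neg, div_neg] at this
    simpa [Rat.neg_den] using this
  obtain ⟨B, rfl⟩ := Int.eq_ofNat_of_zero_le hbpos.le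
  have hB : B ≠ 0 := by omega
  set e := B.factorization p with he
  have hew : e ≤ a.factorization p := by
    by_contra hlt
    apply h
    have h1 : p ^ (a.factorization p + 1) ∣ B :=
      (pow_dvd_pow p (by omega)).trans (Nat.ordProj_dvd B p)
    exact_mod_cast h1
  obtain ⟨a', ha'⟩ : p ^ e ∣ a := (pow_dvd_pow p hew).trans (Nat.ordProj_dvd a p)
  have hBsplit : p ^ e * (B / p ^ e) = B := Nat.ordProj_mul_ordCompl_eq_self B p
  set B' := B / p ^ e with hB'
  have hcop : Nat.Coprime p B' := Nat.coprime_ordCompl hp hB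
  have hpe : (p : ℚ) ^ e ≠ 0 := pow_ne_zero _ (by exact_mod_cast hp.ne_zero)
  have hB'0 : (B' : ℚ) ≠ 0 := by
    have : B' ≠ 0 := fun h0 => by rw [h0, mul_zero] at hBsplit; exact hB hBsplit.symm
    exact_mod_cast this
  have hx : ((a : ℚ) / ((B : ℕ) : ℤ)) = ((a' : ℤ) : ℚ) / (B' : ℕ) := by
    rw [ha', ← hBsplit]
    push_cast
    field_simp
  rw [hx]
  intro hd
  have hden : (((a' : ℤ) : ℚ) / (B' : ℕ)).den ∣ B' := by
    have h := Rat.den_dvd a' B'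
    rw [Rat.divInt_eq_div] at h
    push_cast at h
    exact_mod_cast h
  have := Nat.Coprime.eq_one_of_dvd (hcop.coprime_dvd_right hden) (by simpa using hd)
  exact hp.one_lt.ne' this

end PIntegral

/-! ### The zeros `−n+θ, …, θ` of `R_n` and the window identity (3.5) -/

/-- **The zeros of `R_n` at `ℓ − k + θ`** (`0 ≤ ℓ ≤ k ≤ n`, `θ ∈ 𝓕_B`, `θ < 1`, `rn = um ≥ 1`): the
numerator contains the factor `t − rn + j + θ'` with `θ' = 1 − θ ∈ 𝓕_B`, `j = rn + k − ℓ − 1`.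
[cite: LaiYu2020, Lemma 3.3 (proof: "R_n(t) has zeros −n+θ, …, θ for θ ∈ 𝓕_B ∖ {1}")] -/
theorem R_shift_eq_zero {u v s : ℕ} {B : ℝ} {m : ℕ} (hum : 1 ≤ u * m) {θ : ℚ} (hθ : θ ∈ zeroSet B)
    (hθ1 : θ < 1) {k ℓ : ℕ} (hℓk : ℓ ≤ k) (hkn : k ≤ v * m) :
    R u v s B m ((ℓ : ℚ) - k + θ) = 0 := by
  rw [R]
  have hmem : (1 - θ) ∈ (zeroSet_finite B).toFinset :=
    (zeroSet_finite B).mem_toFinset.2 (one_sub_mem_zeroSet hθ hθ1)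
  have hj : u * m + k - ℓ - 1 ∈ range ((2 * u + v) * m) := by
    rw [mem_range]
    have : u * m + k - ℓ - 1 < u * m + v * m := by omega
    nlinarith
  have hzero : ∏ θ' ∈ (zeroSet_finite B).toFinset, ∏ j ∈ range ((2 * u + v) * m),
      ((ℓ : ℚ) - k + θ - u * m + j + θ') = 0 := by
    refine prod_eq_zero hmem (prod_eq_zero hj ?_)
    rw [Nat.cast_sub (by omega : 1 ≤ u * m + k - ℓ), Nat.cast_sub (by omega : ℓ ≤ u * m + k)]
    push_cast
    ring
  rw [hzero, mul_zero, mul_zero, zero_div]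

/-- `m + θ ≠ 0` for an integer `m` and `θ ∈ 𝓕_B ∖ {1}` (`0 < θ < 1`). [folklore] -/
private theorem intCast_add_ne_zero {B : ℝ} {θ : ℚ} (hθ : θ ∈ zeroSet B) (hθ1 : θ < 1) (z : ℤ) :
    (z : ℚ) + θ ≠ 0 := by
  obtain ⟨h0, -, -⟩ := (mem_zeroSet).1 hθ
  intro h
  have hz : θ = -z := by linarith
  have h1 : (0 : ℚ) < -z := by linarith
  have h2 : (-z : ℚ) < 1 := by linarith
  have h3 : (0 : ℤ) < -z := by exact_mod_cast h1
  have h4 : (-z : ℤ) < 1 := by exact_mod_cast h2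
  omega

/-- **Eq. (3.5)**: `∑_{k' ≤ n} E_{k'}(ℓ − k + k') = 0` for `0 ≤ ℓ ≤ k ≤ n`, `θ ∈ 𝓕_B ∖ {1}`, where
`E_{k'}(m) = ∑_{o ≤ s} d^{s+1} c_{o,k'}/(m+θ)^{o+1}` (the expansion of `R_n` at its zero `ℓ − k + θ`).
[cite: LaiYu2020, Lemma 3.3 (proof, via the zeros of R_n); FSZ2019 eq. (3.5)] -/
theorem sum_innerSum_window_eq_zero {u v s : ℕ} {B : ℝ} {m : ℕ} (hum : 1 ≤ u * m)
    {c : ℕ → ℕ → ℚ}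
    (hc : ∀ t : ℚ, (∀ p : ℕ, p ≤ v * m → t + p + 1 ≠ 0) →
      pfEval (v * m) (s + 1) c t = R u v s B m (t + 1))
    (d : ℕ) {θ : ℚ} (hθ : θ ∈ zeroSet B) (hθ1 : θ < 1) {k ℓ : ℕ} (hℓk : ℓ ≤ k) (hkn : k ≤ v * m) :
    ∑ k' ∈ range (v * m + 1), ∑ o ∈ range (s + 1),
      (d : ℚ) ^ (s + 1) * c o k' / ((((ℓ : ℤ) - k + k' : ℤ) : ℚ) + θ) ^ (o + 1) = 0 := by
  set t : ℚ := (ℓ : ℚ) - k + θ - 1 with ht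
  have ht' : ∀ p', p' ≤ v * m → t + p' + 1 ≠ 0 := by
    intro p' _ h0
    apply intCast_add_ne_zero hθ hθ1 ((ℓ : ℤ) - k + p')
    push_cast
    rw [ht] at h0
    linarith
  have hR : R u v s B m (t + 1) = 0 := by
    rw [ht, show (ℓ : ℚ) - k + θ - 1 + 1 = (ℓ : ℚ) - k + θ by ring]
    exact R_shift_eq_zero hum hθ hθ1 hℓk hkn
  have h := hc t ht'
  rw [hR, pfEval] at h
  have h2 : ∑ k' ∈ range (v * m + 1), ∑ o ∈ range (s + 1),
      (d : ℚ) ^ (s + 1) * c o k' / ((((ℓ : ℤ) - k + k' : ℤ) : ℚ) + θ) ^ (o + 1) =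
      (d : ℚ) ^ (s + 1) * ∑ p ∈ range (v * m + 1), ∑ o ∈ range (s + 1), c o p / (t + p + 1) ^ (o + 1) := by
    rw [mul_sum]
    refine sum_congr rfl fun k' _ => ?_
    rw [mul_sum]
    refine sum_congr rfl fun o _ => ?_
    rw [ht]
    push_cast
    ring_nf
  rw [h2, h, mul_zero]

/-! ### `p`-integrality of the inner sums and the proof of `d^{s+1} ρ_{0,θ} ∈ ℤ` -/

/-- For a good point `m'` (`p^{v_p(db)+1} ∤ b m' + a`, `θ = a/b`), `E_{k'}(m')` is `p`-integral: each
term is `(d^{s−o} c_{o,k'}) · (db/(bm'+a))^{o+1}`. [cite: LaiYu2020, Lemma 3.3 (proof); FSZ2019 §3 proof of Lemma 2] -/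
private theorem pIntegral_innerSum {u v s : ℕ} {B : ℝ} {m : ℕ} (hm : 0 < m) (hv : 0 < v)
    {d : ℕ} (hdiv : ∀ j : ℕ, 1 ≤ j → j ≤ v * m → j ∣ d) {c : ℕ → ℕ → ℚ}
    (hc : ∀ t : ℚ, (∀ p : ℕ, p ≤ v * m → t + p + 1 ≠ 0) →
      pfEval (v * m) (s + 1) c t = R u v s B m (t + 1))
    {θ : ℚ} (hθ : θ ∈ zeroSet B) (hθ1 : θ < 1) {p : ℕ} (hp : p.Prime) (k' : ℕ) (hk' : k' ≤ v * m)
    (m' : ℤ) (hgood : ¬ (p : ℤ) ^ ((d * θ.den).factorization p + 1) ∣ (θ.den : ℤ) * m' + θ.num) :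
    ¬ p ∣ (∑ o ∈ range (s + 1), (d : ℚ) ^ (s + 1) * c o k' / ((m' : ℚ) + θ) ^ (o + 1)).den := by
  have hb0 : (θ.den : ℚ) ≠ 0 := by exact_mod_cast θ.pos.ne'
  have hmθ : (m' : ℚ) + θ = ((θ.den : ℚ) * m' + θ.num) / θ.den := by
    have := Rat.mul_den_eq_num θ
    field_simp
    linarith
  have hb : (θ.den : ℤ) * m' + θ.num ≠ 0 := by
    intro h0
    apply intCast_add_ne_zero hθ hθ1 m'
    have h1 : (θ.den : ℚ) * m' + θ.num = 0 := by exact_mod_cast h0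
    rw [hmθ, h1, zero_div]
  have hbq : (θ.den : ℚ) * m' + θ.num ≠ 0 := by exact_mod_cast hb
  -- the PF identity in the `a_{i,k}` form, for `lemma33_coeff_isInt`
  have hPF : ∀ t : ℚ, (∀ j ∈ range (v * m + 1), t + j ≠ 0) →
      R u v s B m t = ∑ k ∈ range (v * m + 1), ∑ i ∈ Icc 1 (s + 1), c (i - 1) k / (t + k) ^ i := by
    intro t ht
    have ht' : ∀ p', p' ≤ v * m → (t - 1) + p' + 1 ≠ 0 := by
      intro p' hp' h0
      exact ht p' (mem_range.2 (by omega)) (by linarith)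
    have h := hc (t - 1) ht'
    rw [sub_add_cancel] at h
    rw [← h, pfEval]
    refine sum_congr rfl fun k _ => ?_
    rw [show Icc 1 (s + 1) = Ico 1 (s + 1 + 1) from rfl, sum_Ico_eq_sum_range,
      show s + 1 + 1 - 1 = s + 1 by omega]
    refine sum_congr rfl fun o _ => ?_
    rw [show 1 + o - 1 = o by omega, add_comm 1 o]
    ring
  refine PIntegral.sum hp _ fun o ho => ?_
  have ho' : o ≤ s := Nat.lt_succ_iff.1 (mem_range.1 ho)
  obtain ⟨z, hz⟩ := lemma33_coeff_isInt hm hv hdiv hPF (mem_range.2 (Nat.lt_succ_of_le hk'))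
    (i := o + 1) (mem_Icc.2 ⟨by omega, by omega⟩)
  rw [show o + 1 - 1 = o by omega, show s + 1 - (o + 1) = s - o by omega] at hz
  have hnum : 0 ≤ θ.num := (Rat.num_pos.2 ((mem_zeroSet).1 hθ).1).le
  have hq := PIntegral.div_of_not_pow_dvd hp (d * θ.den) ((θ.den : ℤ) * m' + θ.num) hb hgood
  have hterm : (d : ℚ) ^ (s + 1) * c o k' / ((m' : ℚ) + θ) ^ (o + 1) =
      (z : ℚ) * (((d * θ.den : ℕ) : ℚ) / (((θ.den : ℤ) * m' + θ.num : ℤ) : ℚ)) ^ (o + 1) := by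
    rw [← hz, show s + 1 = (s - o) + (o + 1) by omega, pow_add, hmθ]
    push_cast
    rw [div_pow, div_pow]
    field_simp
    ring
  rw [hterm]
  exact PIntegral.mul hp (PIntegral.intCast hp z) (PIntegral.pow hp hq _)

/-- **The inner sums are integers**: `∑_i d^{s+1} a_{i,k}/(ℓ+θ)^i ∈ ℤ` for `0 ≤ ℓ ≤ k ≤ n`, `θ ∈ 𝓕_B`,
and `d ≠ 0` a common multiple of `1, …, n+1` (`p`-adic window argument for `θ ≠ 1`; directly for
`θ = 1`). [cite: LaiYu2020, Lemma 3.3 (proof: "∑ d_{n+1}^{s+1} a_{i,k}/(ℓ+θ)^i is an integer")] -/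
theorem exists_int_innerSum {u v s : ℕ} {B : ℝ} {m : ℕ} (hm : 0 < m) (hv : 0 < v) (hum : 1 ≤ u * m)
    {d : ℕ} (hd : d ≠ 0) (hdiv : ∀ j : ℕ, 1 ≤ j → j ≤ v * m + 1 → j ∣ d) {c : ℕ → ℕ → ℚ}
    (hc : ∀ t : ℚ, (∀ p : ℕ, p ≤ v * m → t + p + 1 ≠ 0) →
      pfEval (v * m) (s + 1) c t = R u v s B m (t + 1))
    {θ : ℚ} (hθ : θ ∈ zeroSet B) {k ℓ : ℕ} (hℓk : ℓ ≤ k) (hkn : k ≤ v * m) :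
    ∃ z : ℤ, ∑ o ∈ range (s + 1), (d : ℚ) ^ (s + 1) * c o k / ((ℓ : ℚ) + θ) ^ (o + 1) = z := by
  have hdiv' : ∀ j : ℕ, 1 ≤ j → j ≤ v * m → j ∣ d := fun j h1 h2 => hdiv j h1 (by omega)
  obtain ⟨hθ0, hθle, -⟩ := (mem_zeroSet).1 hθ
  have hnum : ((θ.num.toNat : ℕ) : ℤ) = θ.num := Int.toNat_of_nonneg (Rat.num_pos.2 hθ0).le
  rcases hθle.lt_or_eq with hθ1 | rfl
  · -- `θ < 1`: `p`-integral for every `p`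
    refine PIntegral.exists_int_of_forall fun p hp => ?_
    by_cases hgood : (p : ℤ) ^ ((d * θ.den).factorization p + 1) ∣ (θ.den : ℤ) * ℓ + θ.num
    · -- `ℓ` is bad: all other points of the window are good, use (3.5)
      have hwin := sum_innerSum_window_eq_zero hum hc d hθ hθ1 hℓk hkn
      rw [← add_sum_erase _ _ (mem_range.2 (Nat.lt_succ_of_le hkn))] at hwin
      have hkk : (((ℓ : ℤ) - k + k : ℤ) : ℚ) = ℓ := by push_cast; ring
      rw [hkk] at hwin
      rw [eq_neg_of_add_eq_zero_left hwin]
      refine PIntegral.neg (PIntegral.sum hp _ fun k' hk' => ?_)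
      have hk'n : k' ≤ v * m := Nat.lt_succ_iff.1 (mem_range.1 (mem_of_mem_erase hk'))
      have hk'k : k' ≠ k := ne_of_mem_erase hk'
      have := pIntegral_innerSum hm hv hdiv' hc hθ hθ1 hp k' hk'n ((ℓ : ℤ) - k + k') fun hbad => ?_
      · simpa using this
      rw [← hnum] at hgood hbad
      refine not_two_bad hp hd θ.pos.ne' (fun j h1 h2 => by exact_mod_cast hdiv' j h1 h2)
        (m₁ := (ℓ : ℤ)) (m₂ := (ℓ : ℤ) - k + k') ?_ ?_ hgood hbad
      · intro h; apply hk'k; omega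
      · rw [show (ℓ : ℤ) - ((ℓ : ℤ) - k + k') = k - k' by ring]; omega
    · have := pIntegral_innerSum hm hv hdiv' hc hθ hθ1 hp k hkn (ℓ : ℤ) hgood
      simpa using this
  · -- `θ = 1`: directly, `(ℓ + 1) ∣ d`
    obtain ⟨q, hq⟩ := hdiv (ℓ + 1) (by omega) (by omega)
    have hPF : ∀ t : ℚ, (∀ j ∈ range (v * m + 1), t + j ≠ 0) →
        R u v s B m t = ∑ k ∈ range (v * m + 1), ∑ i ∈ Icc 1 (s + 1), c (i - 1) k / (t + k) ^ i := by
      intro t ht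
      have ht' : ∀ p', p' ≤ v * m → (t - 1) + p' + 1 ≠ 0 := by
        intro p' hp' h0
        exact ht p' (mem_range.2 (by omega)) (by linarith)
      have h := hc (t - 1) ht'
      rw [sub_add_cancel] at h
      rw [← h, pfEval]
      refine sum_congr rfl fun k _ => ?_
      rw [show Icc 1 (s + 1) = Ico 1 (s + 1 + 1) from rfl, sum_Ico_eq_sum_range,
        show s + 1 + 1 - 1 = s + 1 by omega]
      refine sum_congr rfl fun o _ => ?_
      rw [show 1 + o - 1 = o by omega, add_comm 1 o]
      ring
    have h : ∀ o ∈ range (s + 1), ∃ z : ℤ,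
        (d : ℚ) ^ (s + 1) * c o k / ((ℓ : ℚ) + 1) ^ (o + 1) = z := by
      intro o ho
      have ho' : o ≤ s := Nat.lt_succ_iff.1 (mem_range.1 ho)
      obtain ⟨z, hz⟩ := lemma33_coeff_isInt hm hv hdiv' hPF (mem_range.2 (Nat.lt_succ_of_le hkn))
        (i := o + 1) (mem_Icc.2 ⟨by omega, by omega⟩)
      rw [show o + 1 - 1 = o by omega, show s + 1 - (o + 1) = s - o by omega] at hz
      refine ⟨z * q ^ (o + 1), ?_⟩
      have hdq : (d : ℚ) = ((ℓ : ℚ) + 1) * q := by exact_mod_cast hq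
      have hpow : (d : ℚ) ^ (o + 1) = ((ℓ : ℚ) + 1) ^ (o + 1) * (q : ℚ) ^ (o + 1) := by
        rw [hdq, mul_pow]
      push_cast
      rw [← hz, show s + 1 = (s - o) + (o + 1) by omega, pow_add, hpow]
      have hℓ0 : (ℓ : ℚ) + 1 ≠ 0 := by positivity
      field_simp
    choose! z hz using h
    refine ⟨∑ o ∈ range (s + 1), z o, ?_⟩
    push_cast
    exact sum_congr rfl hz

/-- **Lai–Yu 2020, Lemma 3.3, second half** (PROVED): for every `θ ∈ 𝓕_B` and every common multiple
`d` of `1, …, n+1` — in particular `d = d_{n+1}` — `d^{s+1} ρ_{0,θ} ∈ ℤ`, where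
`ρ_{0,θ} = −∑_{k ≤ n} ∑_{ℓ ≤ k} ∑_{i} a_{i,k}/(ℓ+θ)^i` (as in `lemma25`). Hypotheses: `rn = um ≥ 1`
(zeros of `R_n`) and the partial-fraction data `c_{o,k} = a_{o+1,k}` of `R_n`.
[cite: LaiYu2020, Lemma 3.3 (d_{n+1}^{s+1} ρ_{0,θ} ∈ ℤ)] -/
theorem lemma33_rhoZero_isInt {u v s : ℕ} {B : ℝ} {m : ℕ} (hm : 0 < m) (hv : 0 < v) (hum : 1 ≤ u * m)
    {d : ℕ} (hdiv : ∀ j : ℕ, 1 ≤ j → j ≤ v * m + 1 → j ∣ d) {c : ℕ → ℕ → ℚ}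
    (hc : ∀ t : ℚ, (∀ p : ℕ, p ≤ v * m → t + p + 1 ≠ 0) →
      pfEval (v * m) (s + 1) c t = R u v s B m (t + 1))
    {θ : ℚ} (hθ : θ ∈ zeroSet B) :
    ∃ z : ℤ, (d : ℚ) ^ (s + 1) *
      (-∑ k ∈ range (v * m + 1), ∑ ℓ ∈ range (k + 1), ∑ o ∈ range (s + 1),
          c o k / ((ℓ : ℚ) + θ) ^ (o + 1)) = z := by
  rcases eq_or_ne d 0 with rfl | hd
  · exact ⟨0, by simp⟩
  have h : ∀ k ∈ range (v * m + 1), ∀ ℓ ∈ range (k + 1), ∃ z : ℤ,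
      ∑ o ∈ range (s + 1), (d : ℚ) ^ (s + 1) * c o k / ((ℓ : ℚ) + θ) ^ (o + 1) = z := by
    intro k hk ℓ hℓ
    exact exists_int_innerSum hm hv hum hd hdiv hc hθ (Nat.lt_succ_iff.1 (mem_range.1 hℓ))
      (Nat.lt_succ_iff.1 (mem_range.1 hk))
  choose! z hz using h
  refine ⟨-∑ k ∈ range (v * m + 1), ∑ ℓ ∈ range (k + 1), z k ℓ, ?_⟩
  rw [mul_neg, mul_sum]
  push_cast
  congr 1
  refine sum_congr rfl fun k hk => ?_
  rw [mul_sum]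
  refine sum_congr rfl fun ℓ hℓ => ?_
  rw [← hz k hk ℓ hℓ, mul_sum]
  refine sum_congr rfl fun o _ => ?_
  ring

end Literature.NumberTheory.Irrationality.LaiYu2020

end
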